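import Summits.BirchSwinnertonDyer.BirchSwinnertonDyer.Theorems.QuadraticBranchSignedControlPlusEtaLowerInclusionValuationSqueezeLeadingCoeff
import Summits.BirchSwinnertonDyer.Rank1Residual.Additive.CyclotomicTowerSignedSelmerDual
import Literature.NumberTheory.EllipticCurves.IwasawaEulerCharDualityProofs
import HarnessLib

/-!
# Route `QuadraticBranchSignedControl` (rung K8, cell `bsd-potss`), crux `PlusEtaLowerInclusion`
# (item stmt-BirchSwinnertonDyer-19601): the leading coefficient of `Char X⁺(V/K_∞)^η` COUNTS the
# `Γ`-invariant classes of `Sel⁺(V/K_∞)^η` that are `(γ − 1)`-divisible — the crux at a tower-onto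
# pair of any rank, DESCENDED to the discrete Selmer group

WHAT. Fourth file of the valuation-squeeze road (p499967, p500695, `…LeadingCoeff.lean`): there the
`r`-th coefficient (`r = rank V^{(p*)}(ℚ)`) of a characteristic power series `ξ_η` of
`X_η = X⁺(V/K₀ℚ_∞)^η` was identified, at a tower-onto pair carrying the `V`-certificate and
`coeff_r L_p⁺(V,η,T) ≠ 0`, with `#coker(φ_{X_η} : X_η[T] → X_η/TX_η)` (up to `ℤ_p^×`). By the tree's
PROVED Pontryagin duality for the `Γ`-Euler characteristic
(`IwasawaDual.IsDualPair.natCard_coker_bockstein`: `#coker φ_X = #ker φ_S`, CSS 2003 §3 (30)–(31))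
applied to the dual pair `(X_η, Sel⁺(V/K₀ℚ_∞)^η)` (`EtaSignedSelmerDualData.isDualPair`, the tame case
`p ∤ [K₀ : ℚ]` discharged by `kappa_surjOn_galRange_cyclotomic`), THIS FILE states the same on the
DISCRETE side, where descents live:

  `coeff_r ξ_η = u · #ker(φ_S : S^Γ → S_Γ)`,  `S = Sel⁺(V/K₀ℚ_∞)^η`,  `u ∈ ℤ_p^×`,
  `ker φ_S = {s ∈ S : conj_γ s = s and s ∈ (conj_γ − 1) S}`,

and hence (§2) the crux at the pair in DISCRETE SELMER SHAPE:

  (E⁺_η)(V, p) ⟸ named facts + certificates + `p^v ∣ #{s ∈ S^Γ : s ∈ (γ−1)S}`,  `p^{v+1} ∤ coeff_r L_p⁺(V,η,T)`.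

For `r = 0` (`X_η[T] = 0`, so `S = (γ−1)S`): `ker φ_S = S^Γ ⊇ res Sel_{p^∞}(W/ℚ)`, recovering the
rank-zero Selmer-shape roads. For `r = 1`: the per-pair residue of crux 19601 is the `p`-DIVISIBILITY IN
THE TOWER of `Γ`-invariant `η`-classes — which classes of `S^Γ` (a relaxed Selmer group of `W` over
`ℚ`: Tamagawa conditions dropped at `ℓ ≠ p`, level-`∞` plus condition at `p`) are `(γ−1)`-divisible
in `S`; `#ker φ_S ≥ #(S^Γ/S^Γ_div) ≥ #coker(Sel_{p^∞}(W/ℚ) → S^Γ)` is the natural next inequality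
(NOT proved here). Nothing about the size of `ker φ_S` is asserted for any pair.

HONEST FRAMING (cell `bsd-potss`, run/shared/lean/pub/bsd-potss/; FULL-BSD rank ≤ 1 programme, HUMAN
RULING D-0036/D-0074): TOOL THEOREMS ONLY, CONDITIONAL on the named Literature facts (Kobayashi 2003
Thm. 1.2/1.3/2.2η/4.1η, Kitajima–Otsuki 2018 Thm. 1.3 at `η`; hypothesis position), on the tower-onto
hypothesis, the `V`-certificate and the analytic certificate (NOT supplied here for any pair), and in §2
on the per-pair discrete input (OPEN on the rank-one rows). The crux 19601 is OPEN class-wide and NOT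
closed; nothing is booked; `BSD(W, p)` is claimed for no pair. No definition, no named fact, no
`sorry`, axioms standard. Seat `bsd-potss-k8eta-c1` (prover), g3; `--supports stmt-BirchSwinnertonDyer-19601`.

References: [Kobayashi2003] Thm. 1.2/1.3, 2.2, §4 + Thm. 4.1; [KitajimaOtsuki2018] Thm. 1.3;
[CoatesSchneiderSujatha2003] §3 (30)–(31), p. 204; [GreenbergLNM1716] §1 p. 60, §3–4.
-/

set_option autoImplicit false
set_option linter.dupNamespace false
noncomputable section

open scoped Classical
open CongruenceSubgroup Field WeierstrassCurve
open Literature.NumberTheory.EllipticCurves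
open Literature.NumberTheory.EllipticCurves.ModularForms
open Literature.NumberTheory.GaloisRepresentations
open Summit.BirchSwinnertonDyer.Rank1Residual.Additive

namespace Summit.BirchSwinnertonDyer.BirchSwinnertonDyer.Theorems

section Pair

variable {V : WeierstrassCurve ℚ} [V.IsElliptic] [V.IsGloballyMinimal] {p : ℕ} [Fact p.Prime]

/-! ## §1 The leading coefficient on the discrete side -/

/-- **THE LEADING COEFFICIENT OF `Char X⁺(V/K_∞)^η` COUNTS THE `(γ−1)`-DIVISIBLE `Γ`-INVARIANT
CLASSES OF `Sel⁺(V/K_∞)^η`.** GRANTED Kobayashi's Thm. 1.2 / 1.3 / 2.2(η) / 4.1(η) and Kitajima–Otsuki's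
Thm. 1.3 at `η` (NAMED facts), on a good `a_p = 0` pair with `p ≥ 5`, `ρ_{V,p^m}` onto, the
`V`-certificate and `coeff_r L_p⁺(V,η,T) ≠ 0` (`r = rank V^{(p*)}(ℚ)`): for every `η`-datum `D` and
generator `g` of `Char(D.X)`, `coeff_r g = u · #ker φ_S` with `u ∈ ℤ_p^×`, where
`φ_S : S^Γ → S_Γ = S/(γ−1)S` is Coates–Schneider–Sujatha's map for `S = Sel⁺(V/K₀ℚ_∞)^η` with `Γ`
acting by `conj_γ` (`IwasawaDual.eulerMap (conj_γ − 1)`); `ker φ_S = S^Γ ∩ (γ−1)S`. Proof: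
`…LeadingCoeff`'s `coeff_r g ~ #coker φ_{X_η}` and the duality `#coker φ_X = #ker φ_S`
(`IwasawaDual.IsDualPair.natCard_coker_bockstein` on `EtaSignedSelmerDualData.isDualPair`).
CONDITIONAL on the displayed inputs; asserts nothing on the size of `ker φ_S`.
[cite: Kobayashi2003, Thm. 2.2 (p. 5), Thm. 4.1 and §4 (p. 8)] [cite: KitajimaOtsuki2018, Thm. 1.3]
[cite: CoatesSchneiderSujatha2003, §3 (30)–(31) and p. 204] -/
theorem coeff_twistRank_etaCharGenerator_eq_unit_mul_card_ker_eulerMap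
    (h12 : Kobayashi2003.thm12_signedSelmerDual_finite_torsion)
    (h13 : Kobayashi2003.thm41_signedCharIdeal_divisibility)
    (h22 : Kobayashi2003.thm22_etaSignedSelmerDual_finite_torsion)
    (h41 : Kobayashi2003.thm41_plusEtaCharIdeal_dvd)
    (hKO : KitajimaOtsuki2018.mainThm13_etaSignedSelmerDual_noFiniteSubmodule)
    (hp5 : 5 ≤ p) (hgood : V.HasGoodReductionAtPrime p) (hap : V.frobeniusTrace p = 0)
    (hsurj : ∀ m : ℕ, V.HasSurjectiveModNGaloisRep (p ^ m : ℕ))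
    (hcertV : ∀ {N : ℕ} [NeZero N] (f : CuspForm (Gamma0 N) 2), IsNewformOf V f →
      ∃ L : IwasawaAlgebra p, Kobayashi2003.IsSignedPAdicLFunction f p 1 L ∧
        IsUnit (PowerSeries.coeff V.mordellWeilRank L))
    {N : ℕ} [NeZero N] {f : CuspForm (Gamma0 N) 2} (hf : IsNewformOf V f) (ϖ : ℚ)
    (hϖ : if Even (p / 2) then (ϖ : ℝ) * V.realPeriodRat = plusPeriod f
      else (ϖ : ℝ) * V.imaginaryPeriodRat = minusPeriod f)
    (Lη : IwasawaAlgebra p) (hL : IsQuadraticBranchPlusLFunction f p ϖ Lη)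
    (hne : PowerSeries.coeff (V.quadraticTwist ((-1) ^ (p / 2) * p)).mordellWeilRank Lη ≠ 0)
    (K₀ : Type) [Field K₀] [NumberField K₀] [IsCyclotomicExtension {p} ℚ K₀]
    [(galRange (K := ℚ) K₀).Normal] (ηq : absoluteGaloisGroup ℚ →* ℤˣ)
    (hηK : ∀ σ ∈ galRange (K := ℚ) K₀, ηq σ = 1) (hη1 : ηq ≠ 1)
    (κ : ZpExtension ℚ p) (γ : absoluteGaloisGroup ℚ) (hκ : κ.IsCyclotomic) (hγ : κ.IsTopGenerator γ)
    (hγK : γ ∈ galRange (K := ℚ) K₀) (hγc : IsCyclotomicVariable p γ)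
    (D : EtaSignedSelmerDualData V κ K₀ ℚ_[p] ηq γ 1) {g : IwasawaAlgebra p}
    (hg : D.charIdeal = Ideal.span {g}) :
    ∃ u : ℤ_[p]ˣ, PowerSeries.coeff (V.quadraticTwist ((-1) ^ (p / 2) * p)).mordellWeilRank g =
      u * Nat.card (IwasawaDual.eulerMap
        (conjTowerSignedSelmerInftyEta V κ K₀ ℚ_[p] ηq 1 γ - 1)).ker := by
  obtain ⟨u, hu⟩ := coeff_twistRank_etaCharGenerator_eq_unit_mul_card_coker_bockstein h12 h13 h22 h41
    hKO hp5 hgood hap hsurj (fun f hf => hcertV f hf) hf ϖ hϖ Lη hL hne K₀ ηq hηK hη1 κ γ hκ hγ hγK hγc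
    D hg
  have hdual := EtaSignedSelmerDualData.isDualPair V κ K₀ ℚ_[p] ηq 1 D
    (kappa_surjOn_galRange_cyclotomic κ K₀) hγ hγK
  refine ⟨u, ?_⟩
  rw [hu, hdual.natCard_coker_bockstein]

/-! ## §2 The crux at a tower-onto pair of any rank, DISCRETE SELMER SHAPE -/

/-- **(E⁺_η) AT A TOWER-ONTO PAIR OF ANY RANK, DISCRETE SELMER SHAPE.** GRANTED Kobayashi's Thm. 1.2 /
1.3 / 2.2(η) / 4.1(η) and Kitajima–Otsuki's Thm. 1.3 at `η` (NAMED facts), `p ≥ 5`, `V` good with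
`a_p = 0`, `ρ_{V,p^m}` onto, the `V`-certificate, ONE integer `v` with the ANALYTIC certificate
`p^{v+1} ∤ coeff_r L_p⁺(V,η,T)` (`r = rank V^{(p*)}(ℚ)`) and the DISCRETE input: for every admissible
`(K₀, η, κ, γ)`, `p^v` divides the number of `Γ`-invariant classes of `S = Sel⁺(V/K₀ℚ_∞)^η` lying in
`(conj_γ − 1) S` (`#ker φ_S`). Then (E⁺_η)(V, p). (§1 + `…LeadingCoeff`'s Selmer-shape road.) On the
21 rank-one tower-onto census rows this is the OPEN per-pair content of crux 19601, now a statement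
about `p`-divisibility of `η`-Selmer classes in the cyclotomic tower. CONDITIONAL; closes nothing.
[cite: Kobayashi2003, Thm. 2.2 (p. 5), Thm. 4.1 and §4 (p. 8)] [cite: KitajimaOtsuki2018, Thm. 1.3]
[cite: CoatesSchneiderSujatha2003, §3 (30)–(31)] -/
theorem quadraticBranchPlusEtaLowerInclusionAt_of_namedFacts_of_certV_of_kerEulerMapDvd
    (h12 : Kobayashi2003.thm12_signedSelmerDual_finite_torsion)
    (h13 : Kobayashi2003.thm41_signedCharIdeal_divisibility)
    (h22 : Kobayashi2003.thm22_etaSignedSelmerDual_finite_torsion)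
    (h41 : Kobayashi2003.thm41_plusEtaCharIdeal_dvd)
    (hKO : KitajimaOtsuki2018.mainThm13_etaSignedSelmerDual_noFiniteSubmodule)
    (hp5 : 5 ≤ p) (hgood : V.HasGoodReductionAtPrime p) (hap : V.frobeniusTrace p = 0)
    (hsurj : ∀ m : ℕ, V.HasSurjectiveModNGaloisRep (p ^ m : ℕ))
    (hcertV : ∀ {N : ℕ} [NeZero N] (f : CuspForm (Gamma0 N) 2), IsNewformOf V f →
      ∃ L : IwasawaAlgebra p, Kobayashi2003.IsSignedPAdicLFunction f p 1 L ∧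
        IsUnit (PowerSeries.coeff V.mordellWeilRank L))
    (v : ℕ)
    (han : ∀ {N : ℕ} [NeZero N] {f : CuspForm (Gamma0 N) 2}, IsNewformOf V f →
      ∀ (ϖ : ℚ), (if Even (p / 2) then (ϖ : ℝ) * V.realPeriodRat = plusPeriod f
          else (ϖ : ℝ) * V.imaginaryPeriodRat = minusPeriod f) →
      ∀ (Lη : IwasawaAlgebra p), IsQuadraticBranchPlusLFunction f p ϖ Lη →
        ¬ (p : ℤ_[p]) ^ (v + 1) ∣
          PowerSeries.coeff (V.quadraticTwist ((-1) ^ (p / 2) * p)).mordellWeilRank Lη)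
    (hdisc : ∀ (K₀ : Type) [Field K₀] [NumberField K₀] [IsCyclotomicExtension {p} ℚ K₀]
      [(galRange (K := ℚ) K₀).Normal] (ηq : absoluteGaloisGroup ℚ →* ℤˣ),
      (∀ σ ∈ galRange (K := ℚ) K₀, ηq σ = 1) → ηq ≠ 1 →
      ∀ (κ : ZpExtension ℚ p) (γ : absoluteGaloisGroup ℚ),
        κ.IsCyclotomic → κ.IsTopGenerator γ → γ ∈ galRange (K := ℚ) K₀ → IsCyclotomicVariable p γ →
        p ^ v ∣ Nat.card (IwasawaDual.eulerMap
          (conjTowerSignedSelmerInftyEta V κ K₀ ℚ_[p] ηq 1 γ - 1)).ker) :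
    QuadraticBranchPlusEtaLowerInclusionAt V p := by
  refine quadraticBranchPlusEtaLowerInclusionAt_of_namedFacts_of_certV_of_cokerBocksteinDvd h12 h13
    h22 h41 hKO hp5 hgood hap hsurj hcertV v han fun K₀ _ _ _ _ ηq hηK hη1 κ γ hκ hγ hγK hγc D => ?_
  have hdual := EtaSignedSelmerDualData.isDualPair V κ K₀ ℚ_[p] ηq 1 D
    (kappa_surjOn_galRange_cyclotomic κ K₀) hγ hγK
  rw [hdual.natCard_coker_bockstein]
  exact hdisc K₀ ηq hηK hη1 κ γ hκ hγ hγK hγc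

end Pair

end Summit.BirchSwinnertonDyer.BirchSwinnertonDyer.Theorems

end
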